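import Summits.HodgeConjecture.HodgeConjecture.Theorems.SiegelUniversalFamilyFlatFramedFibres
import Literature.AlgebraicGeometry.HodgeTheory.MotivatedClassesDeformation
import HarnessLib

/-!
# Flat-framed, uniformised fibres of the Siegel universal family over a chart ball OF A SMOOTH CLOPEN PIECE

Sub-problem `HodgeConjecture` (cell HC_CM, (U)-lane node U-e P4, G-AN1 «P4 local on the base / P4 on a smooth clopen piece»;
P4 lead B-p03 (g14)).  PIECE EDITION of ★ `UnivFamilyFlatFramedFibres.ue_P4b1a_flatFrameUniformisations_holds`
(`Theorems/SiegelUniversalFamilyFlatFramedFibres.lean`): the base `M ⊗ ℂ` of the complexified universal family of the Siegel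
fine moduli scheme `𝓜 = 𝒜_{g,δ,N}` is replaced by a smooth quasi-projective piece `ι : S′ ⟶ M ⊗ ℂ` (an open immersion, `S′`
smooth of relative dimension `d`), the family by its pullback `f′ := familyPullback.snd (univFamilyℂ 𝓜) ι` (smooth projective,
★ `IsSmoothProjectiveFamily.familyPullback_snd`, hence homotopically locally trivial over `S′(ℂ)`), the base point by a complex
point `t₀` of `S′` with `ι(t₀)` the classifying point of the admissible triple `P₀`, the chart ball `W ∋ t₀` is taken in the
algebraic chart of `S′(ℂ)` at `t₀`, fibre triples `P′ x` are classified at `ι(x)` (★ `exists_triple_isBaseChangeVia_classifyingPoint_eq`)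
and the pinned identification `e x : A_x(ℂ) ≃ₜ X′_x(ℂ)` is extended by ★ `Motives.fiberOverFamilyPullbackIso`.  Every per-fibre
step (flat integral frame on the simply connected ball, [VoisinHodgeI2002] §9.2.1; framed additive analytifications,
[Lange2023AbelianVarietiesComplex] §1.1 Lemma 1.1.17 (a); ample `IsLambdaOfAt` witnesses; the Siegel adelic base marking `m₀` by
`[J(Z₀), r]` with `γ = 1` and its symplectic lift, [Milne2005ShimuraVarieties] Thm. 6.11) is the global proof verbatim, and the
frame bookkeeping lemmas are those of ★ `UnivFamilyFlatFramedFibres`.  Main result: `ue_P4b1a_flatFrameUniformisations_piece_holds`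
(the lead's socket text `UHead.Ue_P4b1a_flatFrameUniformisations_piece`, `IsFlatIntegralFrame` spelled out as its clauses).
HC_CM is proved only modulo the 7 printed citations until rung 0 closes; this helper changes no count.

## References
* [VoisinHodgeI2002] C. Voisin, *Hodge Theory and Complex Algebraic Geometry I*, CUP 2002, §9.2.1 and Thm. 9.3.
* [MumfordFogartyKirwan1994] D. Mumford, J. Fogarty, F. Kirwan, *Geometric Invariant Theory*, 3rd ed., Ch. 7 §3 Thm. 7.9 (p. 139),
  Appendix 7A (pp. 234–235).
* [Lange2023AbelianVarietiesComplex] H. Lange, *Abelian Varieties over the Complex Numbers*, Springer 2023, §1.1.3 Lemma 1.1.17 (a) (p. 14).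
* [Milne2005ShimuraVarieties] J. S. Milne, *Introduction to Shimura Varieties*, §6 Thm. 6.11 pp. 74–75 and (63) p. 116.
* [Hartshorne1977] R. Hartshorne, *Algebraic Geometry*, Springer 1977, III Prop. 9.3 and Prop. 10.1 (base change of smooth proper families).
-/


set_option autoImplicit false
set_option linter.dupNamespace false

noncomputable section

open CategoryTheory CategoryTheory.Limits AlgebraicGeometry Matrix Topology
open Literature.AlgebraicGeometry
open Literature.AlgebraicGeometry.Motives (SchemeOver ComplexPoints AlgPoints specOver AbelianVariety CartierDivisor fiberOver)
open Literature.AlgebraicGeometry.HodgeTheory (ofRatClass ofRatClass_injective)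
open Literature.AlgebraicGeometry.AbelianSchemes (PolarizedAbelianSchemeWithLevel AbelianSchemeOver)
open Literature.AlgebraicGeometry.ModuliOfAbelianVarieties
open Literature.AlgebraicGeometry.ModuliOfAbelianVarieties.SiegelModuli
open Literature.Geometry.Kaehler (ComplexTorus)
open Literature.NumberTheory.Transcendental (IsAnalytification)
open Literature.NumberTheory.Automorphic (siegelUpperHalfSpace)
open Literature.NumberTheory.Adeles
open Literature.AlgebraicTopology.SingularHomology

namespace Summit.HodgeConjecture.HodgeConjecture.Theorems

namespace UnivFamilyFlatFramedFibresPiece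

open UnivFamilyFlatFramedFibres


/-- **SOCKET (B1a-piece) `UHead.Ue_P4b1a_flatFrameUniformisations_piece` DISCHARGED — flat-framed, uniformised fibres of
the pulled-back universal family over a chart ball of a smooth clopen piece at a point classifying an admissible triple.**
Statement = the P4 lead's PieceSockets.v1 text (the pinned `e x := homeomorphOfIso (fibreAVIso (P′ x) ≪≫
(fiberUnivIsoOfIsBaseChangeVia 𝓜 (ι x) (P′ x) (G x) (Ĝ x) (hbc x)).symm ≪≫ (fiberOverFamilyPullbackIso (univFamilyℂ 𝓜) ι x).symm)`),
with the HOME notion `IsFlatIntegralFrame f′ hU γ` written out as its three clauses.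
PROOF. `W` := the chart ball of ★ `exists_chartBall_locallyTrivialOn` at `t₀` for the algebraic chart of `S′(ℂ)` (the pulled-back
family is homotopically locally trivial over all of `S′(ℂ)`, ★ `isHomotopicallyLocallyTrivialOn_univ_of_isSmoothProjectiveFamily` and ★
`IsSmoothProjectiveFamily.familyPullback_snd`); `P′, G, Ĝ, hbc` by ★ `exists_triple_isBaseChangeVia_classifyingPoint_eq` at `ι x`;
`P′ x₀` is admissible (★ `isAdmissibleAt_of_classifyingMap_eq`), whence `m₁, Θ₀, Λ₀`; `m₀` := the `γ = 1` re-base of `m₁` (★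
`exists_rebase_γ_eq_one`); the frame at `x₀` is the `ℤ`-basis of `H¹(X′_{x₀}; ℤ)/tors` pulled back to the lattice classes by
`e x₀ ∘ m₀` (★ `exists_basis_integralLattice_map_eq_latticeClass`), spread to the flat frame `γ` by ★
`exists_flatIntegralFrame_eq_of_simplyConnectedSpace`; at `x ≠ x₀` the uniformisation is ★ `exists_uniformisation_of_basis_integralLattice`
on the `ℤ`-basis `e x^* γ x` (★ `UnivFamilyFlatFramedFibres.exists_basis_integralLattice_of_frame`) and `Θ x` is ★ `Polarization.exists_ample`.
[cite: VoisinHodgeI2002, §9.2.1 and Thm. 9.3] [cite: MumfordFogartyKirwan1994, Ch. 7 §3 Theorem 7.9 (p. 139) and Appendix 7A (pp. 234–235)]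
[cite: Lange2023AbelianVarietiesComplex, §1.1.3 Lemma 1.1.17 (a) (p. 14)] [cite: Milne2005ShimuraVarieties, §6 Thm. 6.11 pp. 74–75 and (63) p. 116] -/
theorem ue_P4b1a_flatFrameUniformisations_piece_holds :
  ∀ (g N : ℕ) (δ : Fin g → ℕ) (_hg : 0 < g) (hδ : IsPolarizationType δ) (_hN : 3 ≤ N)
    (𝓜 : SiegelFineModuliScheme g N δ) (_hMq : HodgeTheory.IsQuasiProjectiveOver 𝓜.M) (_hXq : HodgeTheory.IsQuasiProjectiveOver (W1.univTotal 𝓜))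
    (r : gspFinAdelic δ)
    {S' : SchemeOver ℂ} (ι : S' ⟶ (Motives.baseChange ℚ ℂ).obj 𝓜.M) [IsOpenImmersion ι.left]
    (_hSq : HodgeTheory.IsQuasiProjectiveOver S') (d : ℕ) [SmoothOfRelativeDimension d S'.hom],
    haveI : IsLocallyNoetherian (specOver ℚ ℂ).left :=
      inferInstanceAs (IsLocallyNoetherian (Spec (CommRingCat.of ℂ)))
    haveI : Smooth S'.hom := SmoothOfRelativeDimension.smooth d _
    haveI : LocallyOfFiniteType S'.hom := inferInstance
    r ∈ principalLevelSubgroup δ 1 →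
    ∀ (Z₀ : Matrix (Fin g) (Fin g) ℂ) (hZ₀ : Z₀ ∈ siegelUpperHalfSpace g)
      (P₀ : PolarizedAbelianSchemeWithLevel g N δ (specOver ℚ ℂ).left), IsAdmissibleAt hδ r Z₀ hZ₀ P₀ →
    ∀ (t₀ : ComplexPoints S'),
      AlgPoints.map (L := ℂ) ι t₀ =
        AlgPoints.baseChangeEquiv (algebraMap ℚ ℂ) 𝓜.M (𝓜.classifyingMap (specOver ℚ ℂ) P₀) →
    ∃ (W : Set (ComplexPoints S')) (x₀ : W),
      (x₀ : ComplexPoints S') = t₀ ∧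
      IsOpen W ∧ IsPathConnected W ∧
      W ⊆ (ComplexPoints.algebraicChart S' d
        (x₀ : ComplexPoints S')).source ∧
      ∃ (hU : HodgeTheory.IsCohomologicallyLocallyTrivialOn (Motives.familyPullback.snd (W1.univFamilyℂ 𝓜) ι) W)
        (P' : W → PolarizedAbelianSchemeWithLevel g N δ (specOver ℚ ℂ).left)
        (G : ∀ x : W, (P' x).A.X.left ⟶ 𝓜.univ.A.X.left) (Ĝ : ∀ x : W, (P' x).D.hat.X.left ⟶ 𝓜.univ.D.hat.X.left)
        (hbc : ∀ x : W, (P' x).IsBaseChangeVia 𝓜.univ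
          ((AlgPoints.baseChangeEquiv (algebraMap ℚ ℂ) 𝓜.M).symm (AlgPoints.map (L := ℂ) ι x.1)).left (G x) (Ĝ x))
        (γ : ∀ x : W, Fin g ⊕ Fin g →
          singularCohomology ℚ ℚ (ComplexPoints (fiberOver (Motives.familyPullback.snd (W1.univFamilyℂ 𝓜) ι) x.1)) 1)
        (Φ : ∀ _x : W, (Fin g ⊕ Fin g → ℝ) ≃L[ℝ] (Fin g → ℂ))
        (φ : ∀ x : W, C(ComplexTorus (Φ x), ((P' x).A.fibre (𝟙 (Spec (CommRingCat.of ℂ)))).toAbelianVariety.Points ℂ))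
        (Θ : ∀ x : W, CartierDivisor ((P' x).A.fibre (𝟙 (Spec (CommRingCat.of ℂ)))).toAbelianVariety.X.left)
        (m₀ : SiegelAdelicMarking ⟨jOfSiegel δ Z₀, SiegelComplexRecordSystem.jOfSiegel_mem_C0pm hδ.1 hZ₀⟩ r
          ((P' x₀).A.fibre (𝟙 (Spec (CommRingCat.of ℂ)))).toAbelianVariety)
        (Λ₀ : (P' x₀).level.SymplecticLift (𝟙 (Spec (CommRingCat.of ℂ))) (Θ x₀) δ),
        -- (cls) the fibre triples are classified by their points
        (∀ x : W, AlgPoints.baseChangeEquiv (algebraMap ℚ ℂ) 𝓜.M (𝓜.classifyingMap (specOver ℚ ℂ) (P' x)) = AlgPoints.map (L := ℂ) ι x.1) ∧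
        -- (N1) `γ` is a flat integral frame of `R¹` of the universal family over `W` (the three clauses of
        -- `HodgeTheory.IsFlatIntegralFrame (W1.univFamilyℂ 𝓜) hU γ`)
        ((∀ x : W, LinearIndependent ℂ fun a => ofRatClass _ 1 (γ x a)) ∧
          (∀ (x : W) (c : HodgeTheory.complexBetti (fiberOver (Motives.familyPullback.snd (W1.univFamilyℂ 𝓜) ι) x.1) 1),
            HodgeTheory.IsIntegralClass c ↔ c ∈ Submodule.span ℤ (Set.range fun a => ofRatClass _ 1 (γ x a))) ∧
          ∀ (x x' : W) (p : Path.Homotopic.Quotient x x') (a : Fin g ⊕ Fin g),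
            HodgeTheory.transportFun (Motives.familyPullback.snd (W1.univFamilyℂ 𝓜) ι) 1 hU p (ofRatClass _ 1 (γ x a)) = ofRatClass _ 1 (γ x' a)) ∧
        -- the uniformisations: analytifications, additive, framed by `γ x` through the pinned `e x`
        (∀ x : W, IsAnalytification (Fin g → ℂ)
          ((P' x).A.fibre (𝟙 (Spec (CommRingCat.of ℂ)))).toAbelianVariety.X
          ((P' x).A.fibre (𝟙 (Spec (CommRingCat.of ℂ)))).toAbelianVariety.dim (φ x)) ∧
        (∀ (x : W) (s t : ComplexTorus (Φ x)), φ x (s + t) = φ x s * φ x t) ∧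
        (∀ (x : W) (a : Fin g ⊕ Fin g),
          singularCohomology.map ℚ ℚ
              (((Motives.AlgPoints.homeomorphOfIso (L := ℂ)
                  (W1.fibreAVIso (P' x) ≪≫
                    (W1.fiberUnivIsoOfIsBaseChangeVia 𝓜 (AlgPoints.map (L := ℂ) ι x.1) (P' x) (G x) (Ĝ x) (hbc x)).symm ≪≫
                    (Motives.fiberOverFamilyPullbackIso (W1.univFamilyℂ 𝓜) ι x.1).symm) :
                  ((P' x).A.fibre (𝟙 (Spec (CommRingCat.of ℂ)))).toAbelianVariety.Points ℂ ≃ₜ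
                    ComplexPoints (fiberOver (Motives.familyPullback.snd (W1.univFamilyℂ 𝓜) ι) x.1)) :
                C(((P' x).A.fibre (𝟙 (Spec (CommRingCat.of ℂ)))).toAbelianVariety.Points ℂ,
                  ComplexPoints (fiberOver (Motives.familyPullback.snd (W1.univFamilyℂ 𝓜) ι) x.1))).comp (φ x)) 1 (γ x a) =
            HodgeTheory.latticeClass (Φ x) a) ∧
        -- ample `IsLambdaOfAt` witnesses of the polarisations
        (∀ x : W, (Θ x).IsAmple) ∧
        (∀ x : W, (P' x).A.IsLambdaOfAt (𝟙 (Spec (CommRingCat.of ℂ))) (P' x).D (P' x).pol.lam (Θ x)) ∧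
        -- BASE CASE at `x₀`: the `x₀`-uniformisation IS a marking `m₀` by `[J(Z₀), r]` with `γ = 1` …
        m₀.γ = 1 ∧ m₀.Ψ = Φ x₀ ∧ (∀ t : ComplexTorus (Φ x₀), m₀.toFun t = φ x₀ t) ∧
        -- … and the symplectic lift `Λ₀` of `((P′ x₀).level, Θ x₀)` is matched to `m₀`'s torsion tower
        (∀ ⦃M : ℕ⦄, N ∣ M → M ≠ 0 → ∀ (c : Fin g ⊕ Fin g → ZMod M) (v : Fin g ⊕ Fin g → ℚ),
          AdelicCongr ((r⁻¹ : gspFinAdelic δ) : GL (Fin g ⊕ Fin g) finAdeleQ) 1 v (fun i => ((c i).val : ℚ) / M) →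
            ((Λ₀.lift M (Multiplicative.ofAdd c)) :
                ((P' x₀).A.fibre (𝟙 (Spec (CommRingCat.of ℂ)))).toAbelianVariety.Points ℂ) = m₀.r v) := by
  intro g N δ hg hδ hN 𝓜 hMq hXq r S' ι _ hSq d _ hr1 Z₀ hZ₀ P₀ hP₀ t₀ ht₀
  classical
  haveI : IsLocallyNoetherian (specOver ℚ ℂ).left :=
    inferInstanceAs (IsLocallyNoetherian (Spec (CommRingCat.of ℂ)))
  haveI : Smooth S'.hom := SmoothOfRelativeDimension.smooth d _
  haveI : LocallyOfFiniteType S'.hom := inferInstance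
  -- §A the chart ball `W` at the classifying point `x₀'` of `P₀`
  have hHuniv : HodgeTheory.IsHomotopicallyLocallyTrivialOn (Motives.familyPullback.snd (W1.univFamilyℂ 𝓜) ι)
      (Set.univ : Set (ComplexPoints S')) :=
    HodgeTheory.isHomotopicallyLocallyTrivialOn_univ_of_isSmoothProjectiveFamily
      (Motives.familyPullback.snd (W1.univFamilyℂ 𝓜) ι) d
      (Motives.IsSmoothProjectiveFamily.familyPullback_snd ι
        (UnivFamilyHodgeFrames.isSmoothProjectiveFamily_univFamilyℂ_of_classify 𝓜))
      hSq
  set x₀' : ComplexPoints S' := t₀ with hx₀'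
  obtain ⟨ε, -, -, hWo, hx₀W, -, -, -, -, hWsc, hWpc, hWh, hWc⟩ :=
    HodgeTheory.exists_chartBall_locallyTrivialOn (Motives.familyPullback.snd (W1.univFamilyℂ 𝓜) ι) hHuniv isOpen_univ
      (Set.mem_univ x₀')
      (ComplexPoints.algebraicChart S' d x₀')
      (ComplexPoints.mem_algebraicChart_source _ d x₀') Filter.univ_mem
  set W : Set (ComplexPoints S') :=
    (ComplexPoints.algebraicChart S' d x₀').source ∩
      (ComplexPoints.algebraicChart S' d x₀') ⁻¹'
        Metric.ball (ComplexPoints.algebraicChart S' d x₀' x₀') ε with hW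
  haveI : SimplyConnectedSpace W := hWsc
  obtain ⟨x₀, hx₀⟩ : ∃ x₀ : W, (x₀ : ComplexPoints S') = x₀' :=
    ⟨⟨x₀', hx₀W⟩, rfl⟩
  -- §B fibre triples with base-change witnesses, classified by their points (★ P4a)
  choose P' G Ĝ hbc hcls using fun x : W =>
    𝓜.exists_triple_isBaseChangeVia_classifyingPoint_eq (AlgPoints.map (L := ℂ) ι x.1)
  let e : ∀ x : W, ((P' x).A.fibre (𝟙 (Spec (CommRingCat.of ℂ)))).toAbelianVariety.Points ℂ ≃ₜ
      ComplexPoints (fiberOver (Motives.familyPullback.snd (W1.univFamilyℂ 𝓜) ι) x.1) := fun x =>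
    Motives.AlgPoints.homeomorphOfIso (L := ℂ)
      (W1.fibreAVIso (P' x) ≪≫ (W1.fiberUnivIsoOfIsBaseChangeVia 𝓜 (AlgPoints.map (L := ℂ) ι x.1) (P' x) (G x) (Ĝ x) (hbc x)).symm ≪≫
                    (Motives.fiberOverFamilyPullbackIso (W1.univFamilyℂ 𝓜) ι x.1).symm)
  -- §C base case: `P′ x₀` is admissible; re-base its marking to `γ = 1`
  have hadm : IsAdmissibleAt hδ r Z₀ hZ₀ (P' x₀) :=
    𝓜.isAdmissibleAt_of_classifyingMap_eq hδ P₀ (P' x₀) hP₀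
      ((AlgPoints.baseChangeEquiv (algebraMap ℚ ℂ) 𝓜.M).injective ((hcls x₀).trans (by rw [hx₀, hx₀', ht₀])))
  obtain ⟨m₁, Θ₀, Λ₀, hΘ₀, hlam₀, htower⟩ := hadm
  obtain ⟨m₀, hγ₀1, -, hr₀⟩ := m₁.exists_rebase_γ_eq_one hr1
  let φ₀ : C(ComplexTorus m₀.Ψ, ((P' x₀).A.fibre (𝟙 (Spec (CommRingCat.of ℂ)))).toAbelianVariety.Points ℂ) :=
    ⟨m₀.toFun, m₀.isAnalytification.isHomeomorph.continuous⟩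
  have hψ₀ : IsHomeomorph (((e x₀ : _ ≃ₜ _) : C(_, ComplexPoints (fiberOver (Motives.familyPullback.snd (W1.univFamilyℂ 𝓜) ι) x₀.1))).comp φ₀) :=
    (e x₀).isHomeomorph.comp m₀.isAnalytification.isHomeomorph
  obtain ⟨ℓ₀, hℓ₀⟩ := HodgeTheory.exists_basis_integralLattice_map_eq_latticeClass m₀.Ψ
    (((e x₀ : _ ≃ₜ _) : C(_, ComplexPoints (fiberOver (Motives.familyPullback.snd (W1.univFamilyℂ 𝓜) ι) x₀.1))).comp φ₀) hψ₀
  obtain ⟨hli₀, hint₀⟩ := frame_of_basis_integralLattice m₀.Ψ _ ℓ₀ hℓ₀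
  obtain ⟨γ, hγx₀, hli, hint, htr⟩ :=
    HodgeTheory.exists_flatIntegralFrame_eq_of_simplyConnectedSpace (Motives.familyPullback.snd (W1.univFamilyℂ 𝓜) ι) 1 hWc hWh x₀
      (fun a => ((ℓ₀ a : HodgeTheory.integralLattice (fiberOver (Motives.familyPullback.snd (W1.univFamilyℂ 𝓜) ι) x₀.1) 1) :
        singularCohomology ℚ ℚ (ComplexPoints (fiberOver (Motives.familyPullback.snd (W1.univFamilyℂ 𝓜) ι) x₀.1)) 1)) hli₀ hint₀
  -- §E ample witnesses (`Θ₀` at `x₀`)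
  have hΘex : ∀ x : W, ∃ Θ : CartierDivisor ((P' x).A.fibre (𝟙 (Spec (CommRingCat.of ℂ)))).toAbelianVariety.X.left,
      Θ.IsAmple ∧ (P' x).A.IsLambdaOfAt (𝟙 (Spec (CommRingCat.of ℂ))) (P' x).D (P' x).pol.lam Θ ∧
        (x = x₀ → HEq Θ Θ₀) := by
    intro x
    by_cases hx : x = x₀
    · subst hx
      exact ⟨Θ₀, hΘ₀, hlam₀, fun _ => HEq.rfl⟩
    · obtain ⟨Θ, h1, h2⟩ := (P' x).pol.exists_ample ℂ (𝟙 (Spec (CommRingCat.of ℂ)))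
      exact ⟨Θ, h1, h2, fun h => absurd h hx⟩
  choose Θ hΘamp hΘlam hΘx₀ using hΘex
  have hΘ₀eq : Θ x₀ = Θ₀ := eq_of_heq (hΘx₀ x₀ rfl)
  obtain ⟨Λ₀', hΛ₀'⟩ : ∃ Λ' : (P' x₀).level.SymplecticLift (𝟙 (Spec (CommRingCat.of ℂ))) (Θ x₀) δ,
      ∀ (M : ℕ) (c : Fin g ⊕ Fin g → ZMod M),
        ((Λ'.lift M (Multiplicative.ofAdd c)) :
            ((P' x₀).A.fibre (𝟙 (Spec (CommRingCat.of ℂ)))).toAbelianVariety.Points ℂ) =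
          ((Λ₀.lift M (Multiplicative.ofAdd c)) :
            ((P' x₀).A.fibre (𝟙 (Spec (CommRingCat.of ℂ)))).toAbelianVariety.Points ℂ) := by
    rw [hΘ₀eq]
    exact ⟨Λ₀, fun _ _ => rfl⟩
  -- §F uniformisations framed by `γ x` through `e x` (`m₀` itself at `x₀`)
  have hUex : ∀ x : W, ∃ (Φ : (Fin g ⊕ Fin g → ℝ) ≃L[ℝ] (Fin g → ℂ))
      (φ : C(ComplexTorus Φ, ((P' x).A.fibre (𝟙 (Spec (CommRingCat.of ℂ)))).toAbelianVariety.Points ℂ)),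
      IsAnalytification (Fin g → ℂ)
          ((P' x).A.fibre (𝟙 (Spec (CommRingCat.of ℂ)))).toAbelianVariety.X
          ((P' x).A.fibre (𝟙 (Spec (CommRingCat.of ℂ)))).toAbelianVariety.dim φ ∧
        (∀ s t : ComplexTorus Φ, φ (s + t) = φ s * φ t) ∧
        (∀ a : Fin g ⊕ Fin g, singularCohomology.map ℚ ℚ
            (((e x : _ ≃ₜ _) : C(_, ComplexPoints (fiberOver (Motives.familyPullback.snd (W1.univFamilyℂ 𝓜) ι) x.1))).comp φ) 1 (γ x a) =
          HodgeTheory.latticeClass Φ a) ∧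
        (x = x₀ → Φ = m₀.Ψ ∧ HEq (⇑φ) m₀.toFun) := by
    intro x
    by_cases hx : x = x₀
    · subst hx
      refine ⟨m₀.Ψ, φ₀, m₀.isAnalytification, m₀.toFun_add, fun a => ?_, fun _ => ⟨rfl, HEq.rfl⟩⟩
      rw [hγx₀]
      exact hℓ₀ a
    · obtain ⟨b, hb⟩ := exists_basis_integralLattice_of_frame (e x) (γ x) (hli x) (hint x)
      obtain ⟨Φ, φ, han, hadd, hfr⟩ :=
        HodgeTheory.AbelianVariety.exists_uniformisation_of_basis_integralLattice
          ((P' x).A.fibre (𝟙 (Spec (CommRingCat.of ℂ)))).toAbelianVariety (W1.fibreAV_dim (P' x)) b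
      refine ⟨Φ, φ, han, hadd, fun a => ?_, fun h => absurd h hx⟩
      rw [← singularCohomology.map_map, ← hb a]
      exact hfr a
  choose Φ φ han hadd hframe hUx₀ using hUex
  obtain ⟨hΦ₀, hφ₀⟩ := hUx₀ x₀ rfl
  have hφ₀' : ∀ t : ComplexTorus (Φ x₀), m₀.toFun t = φ x₀ t := fun t =>
    (congrFun (eq_of_heq hφ₀) t).symm
  refine ⟨W, x₀, hx₀, hWo, hWpc, ?_, hWc, P', G, Ĝ, hbc, γ, Φ, φ, Θ, m₀, Λ₀', hcls, ⟨hli, hint, htr⟩, han, hadd,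
    hframe, hΘamp, hΘlam, hγ₀1, hΦ₀.symm, hφ₀', ?_⟩
  · rw [hx₀]
    exact Set.inter_subset_left
  · intro M hNM hM c v hv
    rw [hΛ₀', hr₀]
    exact htower hNM hM c v hv

end UnivFamilyFlatFramedFibresPiece

end Summit.HodgeConjecture.HodgeConjecture.Theorems

end
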